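import Summits.BirchSwinnertonDyer.BirchSwinnertonDyer.Theorems.ManinLocalTwoThreeCDivisionIntegralCDT
import HarnessLib

/-!
# C5 `ManinPrimeToAdditiveFiveLe` (the route's declared RESIDUAL conjunct) — the CONDITIONAL closer of record (modulo the one printed fact CDT)
(route `ManinLocalTwoThree`, residual crux C5 stmt-BirchSwinnertonDyer-22969; cell bsd-f2-manin, LEAD prover seat p1 gen 21; bookkeeping twin of
p2 gen 22's C2/C3 closers of record `…Theorems/ManinLocalTwoThreeManinOddAtFour.lean` / `…ManinPrimeToThreeAtNine.lean`)

`maninLocalTwoThree_maninPrimeToAdditiveFiveLe_of_CDT` concludes the route decl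
`Summit.BirchSwinnertonDyer.BirchSwinnertonDyer.Theses.ManinLocalTwoThree.ManinPrimeToAdditiveFiveLe` BY NAME under exactly one named,
statement-only, PRINTED Literature fact taken as a hypothesis:

* `hCDT : Literature.NumberTheory.Automorphic.CalegariDimitrovTang2025_unboundedDenominators` — Calegari–Dimitrov–Tang, J. Amer. Math. Soc. 38
  (2025) Thm 1 (unbounded denominators), holomorphic-at-the-cusps special case over Mathlib's `ModularForm`.

It is p2 gen 21's `ManinLocalTwoThree.CDivisionInt.maninPrimeToAdditiveFiveLe_of_CDTInt` (p756488): the integer `c`-division witness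
`12·℘_{Λ_W}(ℰ_f)·B_d·Δ^a` (Honda integrality of the `X₀(N)`-parametrisation divided by `c₀`, poles killed with matching orders, bounded at the
cusps) is modular for exactly the stabiliser `Γ^{(c)} = {γ ∈ Γ₀(N) : {∞,γ∞}_f ∈ Λ_W}`; CDT makes that group congruence, the `Γ₁`-Wohlfahrt kernel puts
`Γ₁(N)` inside it, so `Λ₁(f) ⊆ Λ_W = c₀Λ₀(f)`; at an odd prime `p` with `p² ∣ N` this forces `|c₀| = 1`
(`CDivisionInt.abs_maninConstant_eq_one_of_CDTInt_of_odd_sq_dvd`), in particular `p ∤ c₀` for every prime `p ≥ 5` with `p² ∣ N`.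

HONEST FRAMING.  This is a CONDITIONAL result (the gate records `conditional-result`); the item's own signature is NOT proved, because CDT is an
undischarged `def … : Prop` hypothesis (a Literature programme: CDT §§2–6, none of it in Mathlib).  The route binders Mazur / Abbes–Ullmo /
Česnavičius / modularity are unused by this proof.  C5 is the cell's declared residual (not attacked); this file only records, for the ledger, that the
residual has the same single printed input as C3.  BSD is not proved; Manin's conjecture is not proved; C5 stays OPEN as filed.
[cite: CalegariDimitrovTang2025, Thm. 1] [cite: LingOesterle1991, Thm. 6]
-/

set_option autoImplicit false
-- lint-debt: the directory name repeats the summit name (sibling precedent `ManinLocalTwoThreeManinOddAtFour.lean`)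
set_option linter.dupNamespace false

namespace Summit.BirchSwinnertonDyer.BirchSwinnertonDyer.Theorems

/-- **C5 `ManinPrimeToAdditiveFiveLe` modulo {CDT}** (CONDITIONAL closer; the hypothesis is a printed, statement-only Literature fact; nothing
else is assumed): for every globally minimal `W/ℚ`, every level `N`, every lattice-optimal `X₀(N)`-datum and every prime `p ≥ 5` with `p² ∣ N`,
`p ∤ c`.  [cite: CalegariDimitrovTang2025, Thm. 1] [cite: LingOesterle1991, Thm. 6] -/
theorem maninLocalTwoThree_maninPrimeToAdditiveFiveLe_of_CDT
    (hCDT : Literature.NumberTheory.Automorphic.CalegariDimitrovTang2025_unboundedDenominators) :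
    Summit.BirchSwinnertonDyer.BirchSwinnertonDyer.Theses.ManinLocalTwoThree.ManinPrimeToAdditiveFiveLe :=
  ManinLocalTwoThree.CDivisionInt.maninPrimeToAdditiveFiveLe_of_CDTInt hCDT

end Summit.BirchSwinnertonDyer.BirchSwinnertonDyer.Theorems
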